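import Summits.QuantumFields.YangMills.Theorems.FluctuationComparisonRegPrIntLS1aTowerFullWindowMinorant
import Summits.QuantumFields.YangMills.Theorems.FluctuationComparisonRegPrIntLS1aTowerLawInvariance
import HarnessLib

/-!
# `FluctuationComparisonRegPrIntLS1aTowerInvariantVersionPos` — (p) FOR THE FINAL VERSION ⟸ (c): the Γ-averaged canonical version of the cut tower's density is STRICTLY
# POSITIVE at every point of the full `θBal F.L γ b₀ p₀ j`-window as soon as that window lies in its `regSet` — ★★OWNER RULING №86 (2)(i)'s junction by kernel (FILE F,
# the composition of ✓p821840 `…S1aTowerFullWindowMinorant` (this seat, E) with ✓p821154 `…S1aTowerLawInvariance.invariantVersion_spec` (px17 g20))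

Cell `ym3-torus` (YM ladder rung R3 = continuum `SU(2)` Yang–Mills on T³ — NOT d = 4, NOT infinite volume, NOT a mass gap, NOT Clay); width seat
`ym3-torus-px21` (gen 22), WIDTH COPY of ★p1 «CMP 102 Thm 1's inputs AS PRINTED vs AS TYPED, every gap named».  Helper of the crux
`stmt-QuantumFields-20520` `FluctuationComparisonRegPrIntL` (`--kind proof --supports … --as helper`, count-neutral).  THEOREMS ONLY: definition-free,
default heartbeats, no `instance`∕`notation`.

WHAT.  S1aᴴ (`Lines/runpair_organ.lean` :534) wants ONE density `ρ_j` with (p) pointwise positivity on the window, (w), (m), (c) window continuity, (a).  ✓p820872∕✓p821424 give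
(p) ∧ (w) for a MEASURABLE version; px17 g20's ✓p820698∕✓p821154 build from ANY version `ρ₀ j` the Γ-AVERAGED CANONICAL VERSION `canonVersion dU_j (orbAvg (ρ₀ j))` —
gauge invariant, measurable, `≥ 0`, same law, `= ρ₀ j` a.e., continuous on `regSet dU_j (ρ₀ j)` — the version (c)∕(a) will speak about; RULING №86 (2)(i): (p) does NOT
transfer to it for free.  ✓p821840 supplies a continuous strictly positive minorant `g` of every density on the FULL window; `invariantVersion_spec`'s order clause
(`U` open ⊆ `regSet`, `f` continuous on `U`, `f ≤ ρ₀ j` a.e. on `U` ⟹ `f ≤` the Γ-averaged canonical version on `U`) then gives: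
* ★★★`invariantVersion_pos_on_window_of_regSet`: for every `L`, `0 < b₀`, `0 < p₀` there is `γ₁ > 0` such that for every family of block size `L` and `0 < γ ≤ γ₁` there is
  `jV` with: for every measurable, GAUGE-INVARIANT cut `χ` floored by `ofReal (q i)` (`0 < q i`) on the `(19∕20)·θ_i`-windows above `j`, every run system `ν` ∕ cut tower `μ`
  of S1aᴴ's shape, every measurable non-negative version family `ρ₀` of the tower (`μ j = dU_j.withDensity (ofReal ∘ ρ₀ j)`, `j ≤ K`) and every `jV ≤ j ≤ K`:
  **IF the window `{PlaqSmall (θBal F.L γ b₀ p₀ j)}` lies in `regSet dU_j (ρ₀ j)` (= S1aᴴ's (c)-type input, NOT asserted), THEN `0 < canonVersion dU_j (orbAvg (ρ₀ j)) V` at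
  EVERY window point `V`** — (p) for the final version.
* ★★★`invariantVersion_pos_on_window_of_regSet_sfCut`: the same for the line's own (½, 24∕25) cut (gauge invariance ✓`sfCutTerm_gaugeAct`, floor ✓`floor_ofReal_sfCut2425`) —
  NO hypothesis on the cut left; only (c) remains as a hypothesis.
NOTHING of Bałaban's is asserted or proved; (c) is the hypothesis, not a theorem (UV3-NODE §67.3 (c), §77 (px17 g20), (T⊥)♭ (px13 g24)).

HONEST: S1a(ᴴ): (m)-conjunct AS TYPED misstated by currency (★★OWNER RULING №80; repair (R-β1′) requested), AS PRINTED OPEN; (c)∕(a) OPEN; `stub_runClassMembershipH` untouched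
(RULING №86); the five registered stubs of `Lines/semiclassical_s2beta.lean` (3732b7df) ∕ crux 20520 ∕ 19936 ∕ 19200 ∕ `YM3TorusSU2` NOT proved; registry untouched; rung R3 =
SU(2) YM₃ on T³ at fixed lattice data — NOT d = 4, NOT infinite volume, NOT a mass gap, NOT Clay; the Yang–Mills mass gap is NOT proved by any of this.
References: [Balaban1985UV3] CMP 102 (1985) (2) p. 256, (7) p. 257; [Balaban1987RG1] CMP 109 (1987) (0.13) p. 254; [Balaban1985Averaging] CMP 98 (1985) (8), (10) p. 19.
-/

set_option autoImplicit false

noncomputable section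

namespace Summit.QuantumFields.YangMills.Theorems.FluctuationComparisonRegPrIntLS1aTowerInvariantVersionPos

open MeasureTheory Filter Topology Set Function
open scoped ENNReal NNReal BigOperators
open Literature.MathematicalPhysics.QuantumFieldTheory.Balaban1983to89
open T3ContinuumYM3Torus T3NestedUnitLaws T3UnitLawDensityEML T3UnitScaleTilt T3TiltDescent T4Continuum
open Literature.MathematicalPhysics.QuantumFieldTheory.Balaban1983to89.Missing
open Literature.MathematicalPhysics.QuantumFieldTheory.Balaban1983to89.Node00 (canonVersion regSet)
open Literature.MathematicalPhysics.QuantumFieldTheory.Balaban1983to89.T3OrbitAverage (orbAvg)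
open scoped Literature.MathematicalPhysics.QuantumFieldTheory.Balaban1983to89.T3OrbitAverage
open Summit.QuantumFields.YangMills.Theorems.FluctuationComparisonRegPrIntLS1aTowerDensityVersion (isOpen_window)
open Summit.QuantumFields.YangMills.Theorems.FluctuationComparisonRegPrIntLS1aTowerSfCutDock (measurable_ofReal_sfCut2425)
open Summit.QuantumFields.YangMills.Theorems.FluctuationComparisonRegPrIntLS1aTowerFullWindowMinorant
open Summit.QuantumFields.YangMills.Theorems.FluctuationComparisonRegPrIntLS1aTowerLawInvariance (invariantVersion_spec sfCutTerm_gaugeAct)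

/-- ★★★ **(p) FOR THE FINAL (Γ-AVERAGED CANONICAL) VERSION ⟸ (c)**: with the cut gauge invariant and floored on the `(19∕20)·θ`-windows above `j`, for `0 < γ ≤ γ₁(L, b₀, p₀)`, `jV ≤ j ≤ K`
and ANY measurable non-negative version family `ρ₀` of the cut tower: if the `θBal F.L γ b₀ p₀ j`-window lies in `regSet dU_j (ρ₀ j)`, then `canonVersion dU_j (orbAvg (ρ₀ j))`
is strictly positive at every window point (✓p821840 minorant + ✓p821154 order clause). [cite: Balaban1985UV3, (2) p.256 and (7) p.257; Balaban1987RG1, (0.13) p.254] -/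
theorem invariantVersion_pos_on_window_of_regSet (L : ℕ) {b₀ p₀ : ℝ} (hb : 0 < b₀) (hp : 0 < p₀) :
    ∃ γ₁ : ℝ, 0 < γ₁ ∧ ∀ (F : T3Family) (γ : ℝ), F.L = L → 0 < γ → γ ≤ γ₁ → ∃ jV : ℕ,
      ∀ (χ : (i : ℕ) → GaugeField (F.P i) 0 ↥(Matrix.specialUnitaryGroup (Fin 2) ℂ) → ℝ≥0∞), (∀ i, Measurable (χ i)) →
        (∀ i (u : GaugeTransf (F.P i) 0 ↥(Matrix.specialUnitaryGroup (Fin 2) ℂ)) U, χ i (GaugeField.gaugeAct u U) = χ i U) →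
      ∀ (q : ℕ → ℝ), (∀ i, 0 < q i) →
      ∀ (ν : ℕ → (j : ℕ) → Measure (GaugeField (F.P j) 0 ↥(Matrix.specialUnitaryGroup (Fin 2) ℂ))),
        (∀ K, ν K K = T4GenFunBounds.gibbsMeasure (F.P K) ((F.scheme ℰp γ).β K)) →
        (∀ K j, j < K → ν K j = Measure.map (descend F ℰp j) (ν K (j + 1))) →
      ∀ (K Ts : ℕ) (hTs : Ts ≤ K) (μ : (j : ℕ) → Measure (GaugeField (F.P j) 0 ↥(Matrix.specialUnitaryGroup (Fin 2) ℂ))),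
        (∀ j, Ts ≤ j → μ j = ν K j) →
        (∀ j, j < Ts → μ j = Measure.map (descend F ℰp j) ((μ (j + 1)).withDensity (χ (j + 1)))) →
      ∀ (ρ₀ : (j : ℕ) → GaugeField (F.P j) 0 ↥(Matrix.specialUnitaryGroup (Fin 2) ℂ) → ℝ), (∀ j, Measurable (ρ₀ j)) → (∀ j V, 0 ≤ ρ₀ j V) →
        (∀ j, j ≤ K → μ j = (fieldMeasure (F.P j) 0 ↥(Matrix.specialUnitaryGroup (Fin 2) ℂ)).withDensity (fun V => ENNReal.ofReal (ρ₀ j V))) →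
      ∀ (j : ℕ) (_ : jV ≤ j) (hjK : j ≤ K),
        (∀ (i : ℕ), j < i → i ≤ Ts → ∀ U, PlaqSmall (19 / 20 * θBal F.L γ b₀ p₀ i) U → ENNReal.ofReal (q i) ≤ χ i U) →
        {V : GaugeField (F.P j) 0 ↥(Matrix.specialUnitaryGroup (Fin 2) ℂ) | PlaqSmall (θBal F.L γ b₀ p₀ j) V} ⊆
            regSet (fieldMeasure (F.P j) 0 ↥(Matrix.specialUnitaryGroup (Fin 2) ℂ)) (ρ₀ j) →
        ∀ V : GaugeField (F.P j) 0 ↥(Matrix.specialUnitaryGroup (Fin 2) ℂ), PlaqSmall (θBal F.L γ b₀ p₀ j) V →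
          0 < canonVersion (fieldMeasure (F.P j) 0 ↥(Matrix.specialUnitaryGroup (Fin 2) ℂ)) (orbAvg (ρ₀ j)) V := by
  obtain ⟨γ₁, hγ₁, H⟩ := exists_continuous_pos_minorant_fullWindow L hb hp
  refine ⟨γ₁, hγ₁, fun F γ hFL hγ hγle => ?_⟩
  obtain ⟨jV, HV⟩ := H F γ hFL hγ hγle
  refine ⟨jV, fun χ hχm hχinv q hq ν hν1 hν2 K Ts hTs μ hanch hcut ρ₀ hρ₀m hρ₀0 hρ₀w j hjV hjK hfloor hreg V hV => ?_⟩
  -- the continuous positive minorant on the full window (E)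
  obtain ⟨g, hgc, hgpos, hgle⟩ := HV χ hχm q hq ν hν1 hν2 K Ts hTs μ hanch hcut j hjV hjK hfloor
  -- the order clause of the Γ-averaged canonical version (px17 g20)
  obtain ⟨-, -, -, -, -, -, -, hord⟩ := invariantVersion_spec F hγ.le χ hχm hχinv ν hν1 hν2 hTs μ hanch hcut ρ₀ hρ₀m hρ₀0 hρ₀w hjK
  have hle : ∀ᵐ V ∂(fieldMeasure (F.P j) 0 ↥(Matrix.specialUnitaryGroup (Fin 2) ℂ)).restrict
      {V : GaugeField (F.P j) 0 ↥(Matrix.specialUnitaryGroup (Fin 2) ℂ) | PlaqSmall (θBal F.L γ b₀ p₀ j) V}, g V ≤ ρ₀ j V := by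
    refine ae_restrict_of_ae ?_
    filter_upwards [hgle (fun V => ENNReal.ofReal (ρ₀ j V)) (hρ₀w j hjK)] with W hW
    exact (ENNReal.ofReal_le_ofReal_iff (hρ₀0 j W)).mp hW
  exact (hgpos V hV).trans_le ((hord _ (isOpen_window _) hreg).1 g hgc hle V hV)

/-- ★★★ **THE SAME FOR THE LINE'S OWN CUT** (the (½, 24∕25) term: gauge invariance ✓`sfCutTerm_gaugeAct`, floor ✓`floor_ofReal_sfCut2425`): for the `sfCut (θBal F.L γ b₀ p₀ ·)`-cut
tower of S1aᴴ, ANY measurable non-negative version family `ρ₀`, `0 < γ ≤ γ₁(L, b₀, p₀)`, `jV ≤ j ≤ K`: **(c)-type input «window ⊆ `regSet dU_j (ρ₀ j)`» ⟹ the Γ-averaged canonical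
version is strictly positive on the whole window** — the only hypothesis left is (c). [cite: Balaban1985UV3, (2) p.256 and (7) p.257; Balaban1987RG1, (0.13) p.254] -/
theorem invariantVersion_pos_on_window_of_regSet_sfCut (L : ℕ) {b₀ p₀ : ℝ} (hb : 0 < b₀) (hp : 0 < p₀) :
    ∃ γ₁ : ℝ, 0 < γ₁ ∧ ∀ (F : T3Family) (γ : ℝ), F.L = L → 0 < γ → γ ≤ γ₁ → ∃ jV : ℕ,
      ∀ (ν : ℕ → (j : ℕ) → Measure (GaugeField (F.P j) 0 ↥(Matrix.specialUnitaryGroup (Fin 2) ℂ))),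
        (∀ K, ν K K = T4GenFunBounds.gibbsMeasure (F.P K) ((F.scheme ℰp γ).β K)) →
        (∀ K j, j < K → ν K j = Measure.map (descend F ℰp j) (ν K (j + 1))) →
      ∀ (K Ts : ℕ) (hTs : Ts ≤ K) (μ : (j : ℕ) → Measure (GaugeField (F.P j) 0 ↥(Matrix.specialUnitaryGroup (Fin 2) ℂ))),
        (∀ j, Ts ≤ j → μ j = ν K j) →
        (∀ j, j < Ts → μ j = Measure.map (descend F ℰp j) ((μ (j + 1)).withDensity (fun U => ENNReal.ofReal
          (∏ p : Plaq (F.P (j + 1)) 0, max 0 (min 1 ((24 / 25 * θBal F.L γ b₀ p₀ (j + 1) - dist1 (GaugeField.plaqHol U p)) /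
            ((24 / 25 - 1 / 2) * θBal F.L γ b₀ p₀ (j + 1)))))))) →
      ∀ (ρ₀ : (j : ℕ) → GaugeField (F.P j) 0 ↥(Matrix.specialUnitaryGroup (Fin 2) ℂ) → ℝ), (∀ j, Measurable (ρ₀ j)) → (∀ j V, 0 ≤ ρ₀ j V) →
        (∀ j, j ≤ K → μ j = (fieldMeasure (F.P j) 0 ↥(Matrix.specialUnitaryGroup (Fin 2) ℂ)).withDensity (fun V => ENNReal.ofReal (ρ₀ j V))) →
      ∀ (j : ℕ) (_ : jV ≤ j) (_ : j ≤ K),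
        {V : GaugeField (F.P j) 0 ↥(Matrix.specialUnitaryGroup (Fin 2) ℂ) | PlaqSmall (θBal F.L γ b₀ p₀ j) V} ⊆
            regSet (fieldMeasure (F.P j) 0 ↥(Matrix.specialUnitaryGroup (Fin 2) ℂ)) (ρ₀ j) →
        ∀ V : GaugeField (F.P j) 0 ↥(Matrix.specialUnitaryGroup (Fin 2) ℂ), PlaqSmall (θBal F.L γ b₀ p₀ j) V →
          0 < canonVersion (fieldMeasure (F.P j) 0 ↥(Matrix.specialUnitaryGroup (Fin 2) ℂ)) (orbAvg (ρ₀ j)) V := by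
  obtain ⟨γ₁, hγ₁, H⟩ := invariantVersion_pos_on_window_of_regSet L hb hp
  refine ⟨min γ₁ 1, lt_min hγ₁ one_pos, fun F γ hFL hγ hγle => ?_⟩
  have hγ₁' : γ ≤ γ₁ := hγle.trans (min_le_left _ _)
  have hγ1 : γ ≤ 1 := hγle.trans (min_le_right _ _)
  have hLF : 1 ≤ F.L := F.hL.2.le
  obtain ⟨jV, HV⟩ := H F γ hFL hγ hγ₁'
  set χ : (i : ℕ) → GaugeField (F.P i) 0 ↥(Matrix.specialUnitaryGroup (Fin 2) ℂ) → ℝ≥0∞ := fun i U => ENNReal.ofReal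
    (∏ p : Plaq (F.P i) 0, max 0 (min 1 ((24 / 25 * θBal F.L γ b₀ p₀ i - dist1 (GaugeField.plaqHol U p)) /
      ((24 / 25 - 1 / 2) * θBal F.L γ b₀ p₀ i)))) with hχdef
  have hχm : ∀ i, Measurable (χ i) := fun i => measurable_ofReal_sfCut2425 _
  have hχinv : ∀ i (u : GaugeTransf (F.P i) 0 ↥(Matrix.specialUnitaryGroup (Fin 2) ℂ)) U, χ i (GaugeField.gaugeAct u U) = χ i U :=
    fun i u U => sfCutTerm_gaugeAct _ u U
  have hθpos : ∀ i, 0 < θBal F.L γ b₀ p₀ i := fun i => T3MinimiserStabilityReduction.θBal_pos hLF hγ hγ1 hb p₀ i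
  set q : ℕ → ℝ := fun i => (1 / 46 : ℝ) ^ Fintype.card (Plaq (F.P i) 0) with hqdef
  have hq : ∀ i, 0 < q i := fun i => by rw [hqdef]; positivity
  refine ⟨jV, fun ν hν1 hν2 K Ts hTs μ hanch hcut ρ₀ hρ₀m hρ₀0 hρ₀w j hjV hjK hreg V hV => ?_⟩
  have hcut' : ∀ j, j < Ts → μ j = Measure.map (descend F ℰp j) ((μ (j + 1)).withDensity (χ (j + 1))) := hcut
  exact HV χ hχm hχinv q hq ν hν1 hν2 K Ts hTs μ hanch hcut' ρ₀ hρ₀m hρ₀0 hρ₀w j hjV hjK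
    (fun i _ _ U hU => floor_ofReal_sfCut2425 (hθpos i) U hU) hreg V hV

end Summit.QuantumFields.YangMills.Theorems.FluctuationComparisonRegPrIntLS1aTowerInvariantVersionPos

end
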